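import Literature.NumberTheory.Sieve.IwaniecFriableLevelClasses
import Literature.NumberTheory.Sieve.IwaniecAlmostPrimesHolds
import Literature.NumberTheory.Sieve.DivisorBound
import HarnessLib

/-!
# Iwaniec's level of distribution for `n² + 1` over friable moduli, II: the level `x^{1+1/600}`

Topic `Literature/NumberTheory/Sieve`; sequel of `IwaniecFriableLevelClasses.lean`.  H. Iwaniec,
*Almost-primes represented by quadratic polynomials*, Invent. Math. **47** (1978) 171–188,
Corollary of Proposition 1 (p. 176): the remainders `r(𝒜; d) = |𝒜_d| − ρ(d) x / d` of
`𝒜 = {n² + 1 : n ≤ x}` have level of distribution `x^{16/15 − ε}` in BILINEAR form (PROVED in the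
tree, `Iwaniec1978.proposition1_corollary_holds`).  Here the class estimate
`abs_sum_friable_moebius_rem_le` of the prequel (prime cells `⌊T log p⌋`, the Corollary at
`ε = 1/100` as hypothesis) is specialised to `T = x^{1/300}`, `A = x^{1/24}`,
`N = x^{1/15 − 1/100}`, `M = ⌈x^{1 − 4/100}⌉`, and its four terms are absorbed:

* `classes_term_le`, `twoInCell_term_le`, `boundary_term_le` — the `(K+1)(J+1)` Corollary bounds,
  the `d` with two prime factors in one cell, and the boundary layer `(D e^{−1/T}, D]`, each
  `≤ K · x^{e}` with an explicit `e < 1 − 1/1000` (via `ρ(d) ≤ τ(d) ≪ d^{1/3000}`, `DivisorBound`,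
  and the counting lemmas of `FriableCellCounting.lean`); `∑_{d ≤ A} ρ(d) ≪ A` is
  `exists_sum_rho_le`;
* `abs_sum_friable_moebius_rem_le_rpow` — **the level of distribution beyond `x` over friable
  moduli with Möbius weights**: for all sufficiently large `x`, uniformly for `2 ≤ y ≤ x^{1/75}`
  and `1 ≤ D ≤ x^{1 + 1/600}`, `|∑_{d ≤ D, P⁺(d) < ⌈y⌉} μ(d) r(𝒜; d)| ≤ x^{1 − 1/1000}`.

[cite: IwaniecInventiones1978, Corollary p. 176]; the passage from the bilinear form to friable
(well-factorable) supports is the standard one [cite: Greaves2001, Ch. 6, §6.1].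
-/

open Finset Real Filter
open Literature.NumberTheory.Sieve.FriableCell

noncomputable section

namespace Literature.NumberTheory.Sieve.Iwaniec1978

/-! ### Elementary inequalities -/

/-- `cell T q ≤ T log t` whenever `q ≤ t` and `t ≥ 1` (also for `q = 0`). [folklore] -/
theorem cell_le_mul_log {T t : ℝ} (hT : 0 ≤ T) (ht : 1 ≤ t) {q : ℕ} (hq : (q : ℝ) ≤ t) :
    (cell T q : ℝ) ≤ T * Real.log t := by
  unfold cell
  refine (Nat.floor_le (mul_nonneg hT (Real.log_natCast_nonneg q))).trans ?_
  refine mul_le_mul_of_nonneg_left ?_ hT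
  rcases Nat.eq_zero_or_pos q with rfl | hq0
  · rw [Nat.cast_zero, Real.log_zero]; exact Real.log_nonneg ht
  · exact Real.log_le_log (by exact_mod_cast hq0) hq

/-- `⌈t⌉ − 1 ≤ x` (natural subtraction) whenever `0 ≤ t ≤ x`. [folklore] -/
theorem cast_ceil_sub_one_le {t x : ℝ} (ht : 0 ≤ t) (htx : t ≤ x) :
    ((⌈t⌉₊ - 1 : ℕ) : ℝ) ≤ x := by
  have h : ⌈t⌉₊ - 1 ≤ ⌊t⌋₊ := by have := Nat.ceil_le_floor_add_one t; omega
  calc ((⌈t⌉₊ - 1 : ℕ) : ℝ) ≤ ⌊t⌋₊ := by exact_mod_cast h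
    _ ≤ t := Nat.floor_le ht
    _ ≤ x := htx

/-- `e^{1/T} − 1 ≤ 2/T` for `T ≥ 1`. [folklore] -/
theorem exp_one_div_sub_one_le {T : ℝ} (hT : 1 ≤ T) : Real.exp (1 / T) - 1 ≤ 2 / T := by
  have h0 : 0 ≤ 1 / T := by positivity
  have h1 : 1 / T ≤ 1 := (div_le_one (by linarith)).mpr hT
  have h := Real.abs_exp_sub_one_le (x := 1 / T) (by rwa [abs_of_nonneg h0])
  have h2 : 2 * |1 / T| = 2 / T := by rw [abs_of_nonneg h0]; ring
  rw [h2] at h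
  linarith [le_abs_self (Real.exp (1 / T) - 1)]

/-- The length of the boundary layer: `max 0 (⌊D⌋ − D e^{−1/T} + 1) ≤ D/T + 1`. [folklore] -/
theorem max_floor_sub_le {D T : ℝ} (hD : 0 ≤ D) (hT : 0 < T) :
    max 0 ((⌊D⌋₊ : ℝ) - D * Real.exp (-(1 / T)) + 1) ≤ D / T + 1 := by
  refine max_le (by positivity) ?_
  have h1 : (⌊D⌋₊ : ℝ) ≤ D := Nat.floor_le hD
  have h2 : -(1 / T) + 1 ≤ Real.exp (-(1 / T)) := Real.add_one_le_exp _
  have h3 : D * (-(1 / T) + 1) ≤ D * Real.exp (-(1 / T)) := mul_le_mul_of_nonneg_left h2 hD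
  have h4 : D * (-(1 / T) + 1) = D - D / T := by ring
  linarith

/-- Absorption step: `t ≤ K x^e` and `4K ≤ x^{1 − 1/1000 − e}` give `t ≤ x^{1 − 1/1000}/4`.
[folklore] -/
theorem le_rpow_div_four {K e x t : ℝ} (hx : 0 < x) (hK : 4 * K ≤ x ^ (1 - 1 / 1000 - e))
    (ht : t ≤ K * x ^ e) : t ≤ x ^ (1 - 1 / 1000 : ℝ) / 4 := by
  have h1 : x ^ (1 - 1 / 1000 : ℝ) = x ^ (1 - 1 / 1000 - e) * x ^ e := by
    rw [← Real.rpow_add hx]; ring_nf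
  have h2 : 0 ≤ x ^ e := Real.rpow_nonneg hx.le e
  rw [h1]
  nlinarith

/-! ### `ρ ≤ τ ≪ D^{1/3000}` on the exceptional sets -/

/-- `ρ(d) ≤ τ(d) ≤ C_τ X^ν` for `1 ≤ d ≤ X`. [folklore] -/
theorem rho_le_mul_rpow {Cτ ν X : ℝ} (hν : 0 ≤ ν) (hC : 0 ≤ Cτ)
    (hτ : ∀ n : ℕ, n ≠ 0 → ((Nat.divisors n).card : ℝ) ≤ Cτ * (n : ℝ) ^ ν)
    {d : ℕ} (hd : d ≠ 0) (hdX : (d : ℝ) ≤ X) : (rho d : ℝ) ≤ Cτ * X ^ ν := by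
  calc (rho d : ℝ) ≤ (d.divisors.card : ℝ) := by exact_mod_cast rho_le_card_divisors d
    _ ≤ Cτ * (d : ℝ) ^ ν := hτ d hd
    _ ≤ Cτ * X ^ ν := mul_le_mul_of_nonneg_left (Real.rpow_le_rpow (Nat.cast_nonneg d) hdX hν) hC

/-- On any set `s` of `Yn`-friable `d ≤ ⌊D⌋`: `∑_{d ∈ s} ρ(d) ≤ #s · C_τ D^ν`. [folklore] -/
theorem sum_rho_le_card_mul {Cτ ν D : ℝ} (hν : 0 ≤ ν) (hC : 0 ≤ Cτ) (hD : 0 ≤ D)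
    (hτ : ∀ n : ℕ, n ≠ 0 → ((Nat.divisors n).card : ℝ) ≤ Cτ * (n : ℝ) ^ ν)
    {Yn : ℕ} {s : Finset ℕ} (hs : s ⊆ Nat.smoothNumbersUpTo ⌊D⌋₊ Yn) :
    ∑ d ∈ s, (rho d : ℝ) ≤ s.card * (Cτ * D ^ ν) := by
  have hpt : ∀ d ∈ s, (rho d : ℝ) ≤ Cτ * D ^ ν := by
    intro d hd
    have hd' := Nat.mem_smoothNumbersUpTo.mp (hs hd)
    exact rho_le_mul_rpow hν hC hτ (Nat.mem_smoothNumbers.mp hd'.2).1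
      ((Nat.cast_le.mpr hd'.1).trans (Nat.floor_le hD))
  have h := Finset.sum_le_card_nsmul s (fun d => (rho d : ℝ)) (Cτ * D ^ ν) hpt
  rwa [nsmul_eq_mul] at h

/-! ### The three `x`-dependent terms of the class estimate at `T = x^{1/300}` -/

/-- **The `(K+1)(J+1)` Corollary bounds**: with `T = x^{1/300}` and `p, q ≤ x`,
`(cell T p + 1)(cell T q + 1) · C x^{1−1/100} ≤ 10001² C x^{1 − 47/15000}`.
[cite: IwaniecInventiones1978, Corollary p. 176] -/
theorem classes_term_le {x C : ℝ} (hx : 1 ≤ x) (hC : 0 ≤ C) {p q : ℕ} (hp : (p : ℝ) ≤ x)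
    (hq : (q : ℝ) ≤ x) :
    ((cell (x ^ (1 / 300 : ℝ)) p : ℝ) + 1) *
        (((cell (x ^ (1 / 300 : ℝ)) q : ℝ) + 1) * (C * x ^ (1 - 1 / 100 : ℝ))) ≤
      10001 ^ 2 * C * x ^ (1 - 47 / 15000 : ℝ) := by
  have hx0 : 0 < x := by linarith
  set T := x ^ (1 / 300 : ℝ) with hT
  have hT1 : 1 ≤ T := Real.one_le_rpow hx (by norm_num)
  have hL0 : 0 ≤ Real.log x := Real.log_nonneg hx
  have h10001 : (1 + 1 / (1 / 10000 : ℝ)) = 10001 := by norm_num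
  have hlog : 1 + Real.log x ≤ 10001 * x ^ (1 / 10000 : ℝ) := by
    have := one_add_log_le hx (by norm_num : (0 : ℝ) < 1 / 10000)
    rwa [h10001] at this
  -- `T log x + 1 ≤ T (1 + log x) ≤ 10001 T x^{1/10000}`
  have hU : T * Real.log x + 1 ≤ 10001 * x ^ (1 / 300 + 1 / 10000 : ℝ) := by
    rw [Real.rpow_add hx0, ← hT]
    have h1 : T * Real.log x + 1 ≤ T * (1 + Real.log x) := by nlinarith
    have h2 : T * (1 + Real.log x) ≤ T * (10001 * x ^ (1 / 10000 : ℝ)) :=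
      mul_le_mul_of_nonneg_left hlog (by linarith)
    linarith
  have hp' : (cell T p : ℝ) + 1 ≤ 10001 * x ^ (1 / 300 + 1 / 10000 : ℝ) := by
    have := cell_le_mul_log (q := p) (by linarith : 0 ≤ T) hx hp; linarith
  have hq' : (cell T q : ℝ) + 1 ≤ 10001 * x ^ (1 / 300 + 1 / 10000 : ℝ) := by
    have := cell_le_mul_log (q := q) (by linarith : 0 ≤ T) hx hq; linarith
  have hW : 0 ≤ C * x ^ (1 - 1 / 100 : ℝ) := mul_nonneg hC (Real.rpow_nonneg hx0.le _)
  have hc0 : 0 ≤ (cell T q : ℝ) + 1 := by positivity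
  calc ((cell T p : ℝ) + 1) * (((cell T q : ℝ) + 1) * (C * x ^ (1 - 1 / 100 : ℝ)))
      ≤ (10001 * x ^ (1 / 300 + 1 / 10000 : ℝ)) *
          ((10001 * x ^ (1 / 300 + 1 / 10000 : ℝ)) * (C * x ^ (1 - 1 / 100 : ℝ))) :=
        mul_le_mul hp' (mul_le_mul_of_nonneg_right hq' hW) (mul_nonneg hc0 hW) (by positivity)
    _ = 10001 ^ 2 * C * (x ^ (1 / 300 + 1 / 10000 : ℝ) * x ^ (1 / 300 + 1 / 10000 : ℝ) *
          x ^ (1 - 1 / 100 : ℝ)) := by ring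
    _ = 10001 ^ 2 * C * x ^ (1 - 47 / 15000 : ℝ) := by
        rw [← Real.rpow_add hx0, ← Real.rpow_add hx0]; norm_num

/-- **The `d` with two distinct prime factors in one cell** (`T = x^{1/300}`, `D ≤ x^{1+1/600}`,
`Yn ≤ x`): `∑ ρ(d) ≤ #{such d} · C_τ D^{1/3000} ≤ 2·10001·C_τ · x^{1 − 2219/1800000}`, by
`card_twoInCell_le`, `e^{1/T} − 1 ≤ 2/T` and `1 + log x ≤ 10001 x^{1/10000}`. [folklore] -/
theorem twoInCell_term_le {x D Cτ : ℝ} {Yn : ℕ} (hx : 1 ≤ x) (hD0 : 0 ≤ D)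
    (hDx : D ≤ x ^ (1 + 1 / 600 : ℝ)) (hYn : 0 < Yn) (hYx : (Yn : ℝ) ≤ x) (hC : 0 ≤ Cτ)
    (hτ : ∀ n : ℕ, n ≠ 0 → ((Nat.divisors n).card : ℝ) ≤ Cτ * (n : ℝ) ^ (1 / 3000 : ℝ)) :
    ∑ d ∈ (Nat.smoothNumbersUpTo ⌊D⌋₊ Yn).filter (fun d => ∃ q ∈ d.primeFactors,
        ∃ q' ∈ d.primeFactors, q ≠ q' ∧ cell (x ^ (1 / 300 : ℝ)) q = cell (x ^ (1 / 300 : ℝ)) q'),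
        (rho d : ℝ) ≤
      2 * 10001 * Cτ * x ^ (1 - 2219 / 1800000 : ℝ) := by
  have hx0 : 0 < x := by linarith
  set T := x ^ (1 / 300 : ℝ) with hT
  have hT1 : 1 ≤ T := Real.one_le_rpow hx (by norm_num)
  have hT0 : 0 < T := by linarith
  set Bad := (Nat.smoothNumbersUpTo ⌊D⌋₊ Yn).filter (fun d => ∃ q ∈ d.primeFactors,
    ∃ q' ∈ d.primeFactors, q ≠ q' ∧ cell T q = cell T q')
  have hsum : ∑ d ∈ Bad, (rho d : ℝ) ≤ Bad.card * (Cτ * D ^ (1 / 3000 : ℝ)) :=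
    sum_rho_le_card_mul (by norm_num) hC hD0 hτ (Finset.filter_subset _ _)
  have hcard : (Bad.card : ℝ) ≤ ⌊D⌋₊ * (Real.exp (1 / T) - 1) * (1 + Real.log Yn) :=
    card_twoInCell_le hT0 ⌊D⌋₊ Yn
  have hE0 : 0 ≤ Real.exp (1 / T) - 1 := by
    have := Real.add_one_le_exp (1 / T)
    have : 0 ≤ 1 / T := by positivity
    linarith
  have hYn0 : (0 : ℝ) < Yn := by exact_mod_cast hYn
  have hlogY : 1 + Real.log Yn ≤ 1 + Real.log x := by
    have := Real.log_le_log hYn0 hYx; linarith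
  have hlogY0 : 0 ≤ 1 + Real.log Yn := by
    have := Real.log_natCast_nonneg Yn; linarith
  have h10001 : (1 + 1 / (1 / 10000 : ℝ)) = 10001 := by norm_num
  have hlog : 1 + Real.log x ≤ 10001 * x ^ (1 / 10000 : ℝ) := by
    have := one_add_log_le hx (by norm_num : (0 : ℝ) < 1 / 10000)
    rwa [h10001] at this
  have hcard' : (Bad.card : ℝ) ≤ D * (2 / T) * (10001 * x ^ (1 / 10000 : ℝ)) :=
    hcard.trans (mul_le_mul (mul_le_mul (Nat.floor_le hD0) (exp_one_div_sub_one_le hT1) hE0 hD0)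
      (hlogY.trans hlog) hlogY0 (by positivity))
  have hDν : D ^ (1 / 3000 : ℝ) ≤ x ^ ((1 + 1 / 600) * (1 / 3000) : ℝ) := by
    rw [Real.rpow_mul hx0.le]
    exact Real.rpow_le_rpow hD0 hDx (by norm_num)
  calc ∑ d ∈ Bad, (rho d : ℝ) ≤ Bad.card * (Cτ * D ^ (1 / 3000 : ℝ)) := hsum
    _ ≤ D * (2 / T) * (10001 * x ^ (1 / 10000 : ℝ)) *
          (Cτ * x ^ ((1 + 1 / 600) * (1 / 3000) : ℝ)) :=
        mul_le_mul hcard' (mul_le_mul_of_nonneg_left hDν hC) (by positivity) (by positivity)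
    _ ≤ x ^ (1 + 1 / 600 : ℝ) * (2 / T) * (10001 * x ^ (1 / 10000 : ℝ)) *
          (Cτ * x ^ ((1 + 1 / 600) * (1 / 3000) : ℝ)) := by gcongr
    _ = 2 * 10001 * Cτ * (x ^ (1 + 1 / 600 : ℝ) / T * x ^ (1 / 10000 : ℝ) *
          x ^ ((1 + 1 / 600) * (1 / 3000) : ℝ)) := by ring
    _ = 2 * 10001 * Cτ * x ^ (1 - 2219 / 1800000 : ℝ) := by
        rw [hT, ← Real.rpow_sub hx0, ← Real.rpow_add hx0, ← Real.rpow_add hx0]; norm_num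

/-- **The boundary layer `(D e^{−1/T}, D]`** (`T = x^{1/300}`, `D ≤ x^{1+1/600}`): over the
squarefree `Yn`-friable `d` in it,
`∑ ρ(d) ≤ (D/T + 1) · C_τ D^{1/3000} ≤ 2 C_τ x^{1 − 2399/1800000}`, by `card_filter_lt_le` and
`1 − 1/T ≤ e^{−1/T}`. [folklore] -/
theorem boundary_term_le {x D Cτ : ℝ} {Yn : ℕ} (hx : 1 ≤ x) (hD0 : 0 ≤ D)
    (hDx : D ≤ x ^ (1 + 1 / 600 : ℝ)) (hC : 0 ≤ Cτ)
    (hτ : ∀ n : ℕ, n ≠ 0 → ((Nat.divisors n).card : ℝ) ≤ Cτ * (n : ℝ) ^ (1 / 3000 : ℝ)) :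
    ∑ d ∈ ((Nat.smoothNumbersUpTo ⌊D⌋₊ Yn).filter Squarefree).filter
        (fun d : ℕ => D * Real.exp (-(1 / x ^ (1 / 300 : ℝ))) < (d : ℝ)), (rho d : ℝ) ≤
      2 * Cτ * x ^ (1 - 2399 / 1800000 : ℝ) := by
  have hx0 : 0 < x := by linarith
  set T := x ^ (1 / 300 : ℝ) with hT
  have hT1 : 1 ≤ T := Real.one_le_rpow hx (by norm_num)
  have hT0 : 0 < T := by linarith
  set s := (Nat.smoothNumbersUpTo ⌊D⌋₊ Yn).filter Squarefree with hs
  have hsub : s ⊆ Finset.Icc 1 ⌊D⌋₊ := by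
    intro d hd
    rw [hs, Finset.mem_filter, Nat.mem_smoothNumbersUpTo] at hd
    exact Finset.mem_Icc.mpr ⟨Nat.pos_of_ne_zero (Nat.mem_smoothNumbers.mp hd.1.2).1, hd.1.1⟩
  have hR : 0 ≤ D * Real.exp (-(1 / T)) := mul_nonneg hD0 (Real.exp_pos _).le
  have hcard : ((s.filter (fun d : ℕ => D * Real.exp (-(1 / T)) < (d : ℝ))).card : ℝ) ≤
      D / T + 1 :=
    (card_filter_lt_le ⌊D⌋₊ hR s hsub).trans (max_floor_sub_le hD0 hT0)
  have hsum : ∑ d ∈ s.filter (fun d : ℕ => D * Real.exp (-(1 / T)) < (d : ℝ)), (rho d : ℝ) ≤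
      (s.filter (fun d : ℕ => D * Real.exp (-(1 / T)) < (d : ℝ))).card *
        (Cτ * D ^ (1 / 3000 : ℝ)) :=
    sum_rho_le_card_mul (by norm_num) hC hD0 hτ
      ((Finset.filter_subset _ _).trans (Finset.filter_subset _ _))
  have hDν : D ^ (1 / 3000 : ℝ) ≤ x ^ ((1 + 1 / 600) * (1 / 3000) : ℝ) := by
    rw [Real.rpow_mul hx0.le]
    exact Real.rpow_le_rpow hD0 hDx (by norm_num)
  have hDT : D / T + 1 ≤ 2 * x ^ (1 + 1 / 600 - 1 / 300 : ℝ) := by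
    rw [Real.rpow_sub hx0, ← hT]
    have h1 : D / T ≤ x ^ (1 + 1 / 600 : ℝ) / T := div_le_div_of_nonneg_right hDx hT0.le
    have h2 : 1 ≤ x ^ (1 + 1 / 600 : ℝ) / T := by
      rw [le_div_iff₀ hT0, one_mul, hT]
      exact Real.rpow_le_rpow_of_exponent_le hx (by norm_num)
    linarith
  calc ∑ d ∈ s.filter (fun d : ℕ => D * Real.exp (-(1 / T)) < (d : ℝ)), (rho d : ℝ)
      ≤ (s.filter (fun d : ℕ => D * Real.exp (-(1 / T)) < (d : ℝ))).card *
          (Cτ * D ^ (1 / 3000 : ℝ)) := hsum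
    _ ≤ (2 * x ^ (1 + 1 / 600 - 1 / 300 : ℝ)) * (Cτ * x ^ ((1 + 1 / 600) * (1 / 3000) : ℝ)) :=
        mul_le_mul (hcard.trans hDT) (mul_le_mul_of_nonneg_left hDν hC) (by positivity)
          (by positivity)
    _ = 2 * Cτ * (x ^ (1 + 1 / 600 - 1 / 300 : ℝ) * x ^ ((1 + 1 / 600) * (1 / 3000) : ℝ)) := by
        ring
    _ = 2 * Cτ * x ^ (1 - 2399 / 1800000 : ℝ) := by
        rw [← Real.rpow_add hx0]; norm_num

/-! ### The level of distribution `x^{1 + 1/600}` over friable moduli -/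

/-- **Iwaniec's level of distribution beyond `x` for `n² + 1` over friable moduli (Möbius
weights).**  For all sufficiently large `x`, uniformly for `2 ≤ y ≤ x^{1/75}` and
`1 ≤ D ≤ x^{1 + 1/600}`:
`|∑_{d ≤ D, d ⌈y⌉-friable} μ(d) r(𝒜; d)| ≤ x^{1 − 1/1000}`, where `r(𝒜; d) = |𝒜_d| − ρ(d) x/d`,
`𝒜 = {n² + 1 : n ≤ x}`.  From the Corollary of Proposition 1 at `ε = 1/100`
(`proposition1_corollary_holds`) through the class estimate `abs_sum_friable_moebius_rem_le` with
`T = x^{1/300}`, `A = x^{1/24}`. [cite: IwaniecInventiones1978, Corollary p. 176] -/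
theorem abs_sum_friable_moebius_rem_le_rpow :
    ∀ᶠ x : ℝ in Filter.atTop, ∀ y D : ℝ, 2 ≤ y → y ≤ x ^ (1 / 75 : ℝ) → 1 ≤ D →
      D ≤ x ^ (1 + 1 / 600 : ℝ) →
      |∑ d ∈ Nat.smoothNumbersUpTo ⌊D⌋₊ ⌈y⌉₊, (ArithmeticFunction.moebius d : ℝ) * rem x d| ≤
        x ^ (1 - 1 / 1000 : ℝ) := by
  obtain ⟨C₁, hC₁⟩ := proposition1_corollary_holds (1 / 100) (by norm_num)
  obtain ⟨Cρ, -, hCρ⟩ := exists_sum_rho_le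
  obtain ⟨Cτ, hCτ1, hCτ⟩ :=
    Literature.NumberTheory.Sieve.exists_card_divisors_le_mul_rpow (ε := 1 / 3000) (by norm_num)
  have hCτ0 : 0 ≤ Cτ := by linarith
  have hC0 : 0 ≤ max C₁ 0 := le_max_right _ _
  filter_upwards [eventually_ge_atTop (2 : ℝ),
    (tendsto_rpow_atTop (by norm_num : (0 : ℝ) < 1 / 600)).eventually_ge_atTop (2 : ℝ),
    (tendsto_rpow_atTop
      (by norm_num : (0 : ℝ) < 1 - 1 / 1000 - (1 - 47 / 15000))).eventually_ge_atTop
      (4 * (10001 ^ 2 * max C₁ 0)),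
    (tendsto_rpow_atTop (by norm_num : (0 : ℝ) < 1 - 1 / 1000 - 1 / 24)).eventually_ge_atTop
      (4 * Cρ),
    (tendsto_rpow_atTop
      (by norm_num : (0 : ℝ) < 1 - 1 / 1000 - (1 - 2219 / 1800000))).eventually_ge_atTop
      (4 * (2 * 10001 * Cτ)),
    (tendsto_rpow_atTop
      (by norm_num : (0 : ℝ) < 1 - 1 / 1000 - (1 - 2399 / 1800000))).eventually_ge_atTop
      (4 * (2 * Cτ))] with x hx2 hx600 hxa hxb hxc hxd y D hy hyx hD1 hDx
  have hx1 : 1 ≤ x := by linarith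
  have hx0 : 0 < x := by linarith
  have hD0 : 0 ≤ D := by linarith
  have hy0 : 0 ≤ y := by linarith
  have hT0 : 0 < x ^ (1 / 300 : ℝ) := Real.rpow_pos_of_pos hx0 _
  have hA1 : 1 ≤ x ^ (1 / 24 : ℝ) := Real.one_le_rpow hx1 (by norm_num)
  have hA2 : 2 ≤ x ^ (1 / 24 : ℝ) :=
    hx600.trans (Real.rpow_le_rpow_of_exponent_le hx1 (by norm_num))
  have hYn : 0 < ⌈y⌉₊ := Nat.ceil_pos.mpr (by linarith)
  -- `⌈y⌉ ≤ 2y ≤ x^{1/600} x^{1/75} ≤ x`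
  have hYle : (⌈y⌉₊ : ℝ) ≤ x ^ (1 / 600 : ℝ) * x ^ (1 / 75 : ℝ) := by
    have h1 : (⌈y⌉₊ : ℝ) < y + 1 := Nat.ceil_lt_add_one hy0
    have h3 : 2 * y ≤ x ^ (1 / 600 : ℝ) * x ^ (1 / 75 : ℝ) :=
      mul_le_mul hx600 hyx hy0 (Real.rpow_nonneg hx0.le _)
    linarith
  have hYx : (⌈y⌉₊ : ℝ) ≤ x := by
    refine hYle.trans ?_
    rw [← Real.rpow_add hx0]
    exact Real.rpow_le_self_of_one_le hx1 (by norm_num)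
  -- the hypotheses of the class estimate
  have hAY : x ^ (1 / 24 : ℝ) * (⌈y⌉₊ : ℝ) ≤ (⌈x ^ (1 / 15 - 1 / 100 : ℝ)⌉₊ : ℝ) := by
    refine le_trans ?_ (Nat.le_ceil _)
    calc x ^ (1 / 24 : ℝ) * (⌈y⌉₊ : ℝ)
        ≤ x ^ (1 / 24 : ℝ) * (x ^ (1 / 600 : ℝ) * x ^ (1 / 75 : ℝ)) :=
          mul_le_mul_of_nonneg_left hYle (Real.rpow_nonneg hx0.le _)
      _ = x ^ (1 / 15 - 1 / 100 : ℝ) := by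
          rw [← Real.rpow_add hx0, ← Real.rpow_add hx0]; norm_num
  have hDM : (⌊D⌋₊ : ℝ) ≤ x ^ (1 / 24 : ℝ) * (⌈x ^ (1 - 4 * (1 / 100) : ℝ)⌉₊ : ℝ) := by
    calc (⌊D⌋₊ : ℝ) ≤ D := Nat.floor_le hD0
      _ ≤ x ^ (1 + 1 / 600 : ℝ) := hDx
      _ = x ^ (1 / 24 : ℝ) * x ^ (1 - 4 * (1 / 100) : ℝ) := by
          rw [← Real.rpow_add hx0]; norm_num
      _ ≤ x ^ (1 / 24 : ℝ) * (⌈x ^ (1 - 4 * (1 / 100) : ℝ)⌉₊ : ℝ) :=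
          mul_le_mul_of_nonneg_left (Nat.le_ceil _) (Real.rpow_nonneg hx0.le _)
  have hPC : ∀ b : ℕ → ℝ, (∀ n, |b n| ≤ 1) → (∀ n, ¬ Squarefree n → b n = 0) →
      ∑ m ∈ Finset.Ico 1 ⌈x ^ (1 - 4 * (1 / 100) : ℝ)⌉₊,
        |bilinearB x b m (x ^ (1 / 15 - 1 / 100 : ℝ))| ≤ max C₁ 0 * x ^ (1 - 1 / 100 : ℝ) := by
    intro b hb1 hb2
    exact (hC₁ x b hx2 hb1 hb2).trans
      (mul_le_mul_of_nonneg_right (le_max_left _ _) (Real.rpow_nonneg hx0.le _))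
  have hmain := abs_sum_friable_moebius_rem_le hT0 hA1 hD0 hx0.le hAY hDM hPC
  -- the four terms
  have hp : ((⌈y⌉₊ - 1 : ℕ) : ℝ) ≤ x :=
    cast_ceil_sub_one_le hy0 (hyx.trans (Real.rpow_le_self_of_one_le hx1 (by norm_num)))
  have hq : ((⌈x ^ (1 / 15 - 1 / 100 : ℝ)⌉₊ - 1 : ℕ) : ℝ) ≤ x :=
    cast_ceil_sub_one_le (Real.rpow_nonneg hx0.le _)
      (Real.rpow_le_self_of_one_le hx1 (by norm_num))
  have ha := le_rpow_div_four hx0 hxa (classes_term_le hx1 hC0 hp hq)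
  have hb := le_rpow_div_four hx0 hxb (hCρ (x ^ (1 / 24 : ℝ)) hA2)
  have hc := le_rpow_div_four hx0 hxc (twoInCell_term_le (D := D) hx1 hD0 hDx hYn hYx hCτ0 hCτ)
  have hd := le_rpow_div_four hx0 hxd (boundary_term_le (D := D) (Yn := ⌈y⌉₊) hx1 hD0 hDx hCτ0 hCτ)
  linarith [hmain, ha, hb, hc, hd]

end Literature.NumberTheory.Sieve.Iwaniec1978

end
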